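import Mathlib
import Summits.NavierStokesRegularity.NavierStokesRegularity.Theorems.FilamentSkeletonRssClause13FarOperatorSup

/-!
# Clause 13-J/13-R, brick m3b-Fw₂ (FAR OPERATOR AGAINST A WEIGHTED SUP, exponents `0 ≤ p ≤ 2`)

Route `FilamentSkeletonRss`, ∃-side clause 13 (`Clause13RNearStraightL`, stmt-NavierStokesRegularity-23612; typing-agnostic).  Design of record
rev 80–82 (m3b) and lane memo `DESIGN-28296-model-Linfty-g18.md` §3 (m3-w).  Companion of `…Clause13FarOperatorSupWeighted` (`0 ≤ p ≤ 1`): the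
clause's amplified-zone exponent is `b_* ≈ (sup Re β₁ + β₀ + junk)/w₁` with `Re β₁ → ½` and `w/(τ−c) → ½` far out (class identity
`Re β₁ = ¾ − ½w′`), i.e. `b_* ≈ 1 + 2β₀ > 1`; so the weighted bootstrap must allow `p` slightly above `1`.  With `ω(y) = (1+|y−c|/ℓ)^p`,
`0 ≤ p ≤ 2`, the weight is sub-multiplicative up to the QUADRATIC factor `(1+|x−y|/ℓ)²`, which costs one more kernel moment:
* `weight_le_weight_mul_sq` — `ω(y) ≤ ω(x)·(1+|x−y|/ℓ)²`;
* `integral_kernel_mul_norm_le_weightedSup_sq` — `∫K(x−y)‖f(y)‖dy ≤ (‖K‖₁ + 2‖tK‖₁/ℓ + ‖t²K‖₁/ℓ²)·S·ω(x)` when `‖f‖ ≤ S·ω`;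
* ★ `norm_modelOperator_far_le_weighted_sq` — `‖𝓛Y_H(x)‖ ≤ (1+‖k‖₁)S_L + Λ‖P_T(x)‖ + c_k^{ℓ,2}·S·ω(x)`,
  `c_k^{ℓ,2} = Λ₂[(‖t²k′‖₁+‖tk‖₁) + 2(‖t³k′‖₁+‖t²k‖₁)/ℓ + (‖t⁴k′‖₁+‖t³k‖₁)/ℓ²] + (L₁+L₂)[‖tk‖₁ + 2‖t²k‖₁/ℓ + ‖t³k‖₁/ℓ²]`
  (kernel `k` real `C¹`, bounded, `k, tk, t²k, t³k, t²k′, t³k′, t⁴k′ ∈ L¹`).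
Lane ns-filament-19175-p1 g18; `--supports stmt-NavierStokesRegularity-23612 --as helper`.
HONEST FRAMING: bookkeeping about an explicit 1-D model operator attached to a HYPOTHETICAL filament skeleton on the NEGATIVE side of a MODEL route;
nothing here bears on Navier–Stokes regularity or blow-up; 23610/23612 stay OPEN.
-/

noncomputable section

open MeasureTheory Real Complex Filter Set
open scoped ComplexConjugate Topology

namespace Summit.NavierStokesRegularity.NavierStokesRegularity.Theorems.MatchedKernel
set_option linter.dupNamespace false

/-! ## §1 The weight with exponent `≤ 2` and the weighted kernel bound -/

/-- **Sub-multiplicativity, `0 ≤ p ≤ 2`**: `(1+|y−c|/ℓ)^p ≤ (1+|x−c|/ℓ)^p·(1+|x−y|/ℓ)²`. [folklore] -/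
theorem weight_le_weight_mul_sq {ℓ p c : ℝ} (hℓ : 0 < ℓ) (hp0 : 0 ≤ p) (hp2 : p ≤ 2) (x y : ℝ) :
    (1 + |y - c| / ℓ) ^ p ≤ (1 + |x - c| / ℓ) ^ p * (1 + |x - y| / ℓ) ^ 2 := by
  have h0 : 0 ≤ |x - c| / ℓ := by positivity
  have h1 : 0 ≤ |x - y| / ℓ := by positivity
  have htri : 1 + |y - c| / ℓ ≤ (1 + |x - c| / ℓ) * (1 + |x - y| / ℓ) := by
    have ht : |y - c| ≤ |x - y| + |x - c| := by
      have := abs_sub_le y x c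
      rwa [abs_sub_comm y x] at this
    have ht' : |y - c| / ℓ ≤ |x - y| / ℓ + |x - c| / ℓ := by
      rw [← add_div]; exact div_le_div_of_nonneg_right ht hℓ.le
    nlinarith [mul_nonneg h0 h1]
  have hA : (1 : ℝ) ≤ 1 + |x - y| / ℓ := by linarith
  calc (1 + |y - c| / ℓ) ^ p ≤ ((1 + |x - c| / ℓ) * (1 + |x - y| / ℓ)) ^ p :=
        Real.rpow_le_rpow (by positivity) htri hp0
    _ = (1 + |x - c| / ℓ) ^ p * (1 + |x - y| / ℓ) ^ p := Real.mul_rpow (by positivity) (by positivity)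
    _ ≤ (1 + |x - c| / ℓ) ^ p * (1 + |x - y| / ℓ) ^ 2 := by
        refine mul_le_mul_of_nonneg_left ?_ (by positivity)
        have h := Real.rpow_le_rpow_of_exponent_le hA hp2
        rw [show ((2 : ℝ)) = ((2 : ℕ) : ℝ) by norm_num, Real.rpow_natCast] at h
        exact h

/-- **Weighted kernel bound, `0 ≤ p ≤ 2`**: `K, tK, t²K ∈ L¹` real (`|·|`-moments), `‖f(y)‖ ≤ S·(1+|y−c|/ℓ)^p`; then
`∫K(x−y)‖f(y)‖dy ≤ (‖K‖₁ + 2‖tK‖₁/ℓ + ‖t²K‖₁/ℓ²)·S·(1+|x−c|/ℓ)^p`. [folklore] -/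
theorem integral_kernel_mul_norm_le_weightedSup_sq {K : ℝ → ℝ} (hK : Integrable K) (hK1 : Integrable fun t => |t| * |K t|)
    (hK2 : Integrable fun t => t ^ 2 * |K t|)
    {f : ℝ → ℂ} (hfc : Continuous f) {S ℓ p c : ℝ} (hS : 0 ≤ S) (hℓ : 0 < ℓ) (hp0 : 0 ≤ p) (hp2 : p ≤ 2)
    (hf : ∀ y, ‖f y‖ ≤ S * (1 + |y - c| / ℓ) ^ p) (x : ℝ) :
    ∫ y : ℝ, K (x - y) * ‖f y‖ ≤ ((∫ t, |K t|) + 2 * (∫ t, |t| * |K t|) / ℓ + (∫ t, t ^ 2 * |K t|) / ℓ ^ 2) * S * (1 + |x - c| / ℓ) ^ p := by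
  have hKx : Integrable (fun y : ℝ => K (x - y)) := hK.comp_sub_left x
  have hi1 : Integrable fun y : ℝ => |K (x - y)| := hKx.abs
  have hi2 : Integrable fun y : ℝ => |x - y| * |K (x - y)| := hK1.comp_sub_left x
  have hi3 : Integrable fun y : ℝ => (x - y) ^ 2 * |K (x - y)| := hK2.comp_sub_left x
  have hmaj : Integrable fun y : ℝ =>
      (|K (x - y)| + 2 * (|x - y| * |K (x - y)|) / ℓ + (x - y) ^ 2 * |K (x - y)| / ℓ ^ 2) * (S * (1 + |x - c| / ℓ) ^ p) :=
    ((hi1.add ((hi2.const_mul 2).div_const ℓ)).add (hi3.div_const (ℓ ^ 2))).mul_const _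
  have hexp : ∀ y : ℝ, |K (x - y)| * (1 + |x - y| / ℓ) ^ 2
      = |K (x - y)| + 2 * (|x - y| * |K (x - y)|) / ℓ + (x - y) ^ 2 * |K (x - y)| / ℓ ^ 2 := by
    intro y
    rw [← sq_abs (x - y)]
    field_simp
    ring
  have hpt : ∀ y : ℝ, K (x - y) * ‖f y‖
      ≤ (|K (x - y)| + 2 * (|x - y| * |K (x - y)|) / ℓ + (x - y) ^ 2 * |K (x - y)| / ℓ ^ 2) * (S * (1 + |x - c| / ℓ) ^ p) := by
    intro y
    have h1 : K (x - y) * ‖f y‖ ≤ |K (x - y)| * ‖f y‖ := mul_le_mul_of_nonneg_right (le_abs_self _) (norm_nonneg _)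
    have h2 : |K (x - y)| * ‖f y‖ ≤ |K (x - y)| * (S * (1 + |y - c| / ℓ) ^ p) := mul_le_mul_of_nonneg_left (hf y) (abs_nonneg _)
    have h3 : S * (1 + |y - c| / ℓ) ^ p ≤ S * ((1 + |x - c| / ℓ) ^ p * (1 + |x - y| / ℓ) ^ 2) :=
      mul_le_mul_of_nonneg_left (weight_le_weight_mul_sq hℓ hp0 hp2 x y) hS
    calc K (x - y) * ‖f y‖ ≤ |K (x - y)| * (S * ((1 + |x - c| / ℓ) ^ p * (1 + |x - y| / ℓ) ^ 2)) :=
          (h1.trans h2).trans (mul_le_mul_of_nonneg_left h3 (abs_nonneg _))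
      _ = (|K (x - y)| * (1 + |x - y| / ℓ) ^ 2) * (S * (1 + |x - c| / ℓ) ^ p) := by ring
      _ = _ := by rw [hexp y]
  have hL : Integrable (fun y : ℝ => K (x - y) * ‖f y‖) := by
    refine Integrable.mono' hmaj ((hKx.aestronglyMeasurable).mul hfc.norm.aestronglyMeasurable) (ae_of_all _ fun y => ?_)
    rw [Real.norm_eq_abs, abs_mul, abs_of_nonneg (norm_nonneg _)]
    have h2 : |K (x - y)| * ‖f y‖ ≤ |K (x - y)| * (S * (1 + |y - c| / ℓ) ^ p) := mul_le_mul_of_nonneg_left (hf y) (abs_nonneg _)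
    have h3 : S * (1 + |y - c| / ℓ) ^ p ≤ S * ((1 + |x - c| / ℓ) ^ p * (1 + |x - y| / ℓ) ^ 2) :=
      mul_le_mul_of_nonneg_left (weight_le_weight_mul_sq hℓ hp0 hp2 x y) hS
    calc |K (x - y)| * ‖f y‖ ≤ |K (x - y)| * (S * ((1 + |x - c| / ℓ) ^ p * (1 + |x - y| / ℓ) ^ 2)) :=
          h2.trans (mul_le_mul_of_nonneg_left h3 (abs_nonneg _))
      _ = (|K (x - y)| * (1 + |x - y| / ℓ) ^ 2) * (S * (1 + |x - c| / ℓ) ^ p) := by ring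
      _ = _ := by rw [hexp y]
  have hint := integral_mono hL hmaj hpt
  refine hint.trans (le_of_eq ?_)
  have hB : Integrable fun y : ℝ => 2 * (|x - y| * |K (x - y)|) / ℓ := (hi2.const_mul 2).div_const ℓ
  have hC : Integrable fun y : ℝ => (x - y) ^ 2 * |K (x - y)| / ℓ ^ 2 := hi3.div_const (ℓ ^ 2)
  have e1 : ∫ y : ℝ, (|K (x - y)| + 2 * (|x - y| * |K (x - y)|) / ℓ + (x - y) ^ 2 * |K (x - y)| / ℓ ^ 2)
      = (∫ y : ℝ, |K (x - y)|) + (∫ y : ℝ, 2 * (|x - y| * |K (x - y)|) / ℓ) + ∫ y : ℝ, (x - y) ^ 2 * |K (x - y)| / ℓ ^ 2 := by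
    have hAB : Integrable fun y : ℝ => |K (x - y)| + 2 * (|x - y| * |K (x - y)|) / ℓ := hi1.add hB
    rw [integral_add hAB hC, integral_add hi1 hB]
  have e2 : ∫ y : ℝ, |K (x - y)| = ∫ t, |K t| := integral_sub_left_eq_self (fun t => |K t|) volume x
  have e3 : ∫ y : ℝ, 2 * (|x - y| * |K (x - y)|) / ℓ = 2 * (∫ t, |t| * |K t|) / ℓ := by
    rw [integral_div, integral_const_mul, integral_sub_left_eq_self (fun t => |t| * |K t|) volume x]
  have e4 : ∫ y : ℝ, (x - y) ^ 2 * |K (x - y)| / ℓ ^ 2 = (∫ t, t ^ 2 * |K t|) / ℓ ^ 2 := by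
    rw [integral_div, integral_sub_left_eq_self (fun t => t ^ 2 * |K t|) volume x]
  rw [integral_mul_const, e1, e2, e3, e4]
  ring

/-! ## §2 The far operator against the weighted sup -/

/-- ★ **WEIGHTED SUP BOUND FOR `𝓛Y_H`, exponents `0 ≤ p ≤ 2`.**  As `norm_modelOperator_far_le_weighted` with moreover `t³k, t⁴k′ ∈ L¹`; then
`‖𝓛Y_H(x)‖ ≤ (1+‖k‖₁)S_L + Λ‖P_T(x)‖ + c_k^{ℓ,2}·S·(1+|x−c|/ℓ)^p`,
`c_k^{ℓ,2} = Λ₂[(‖t²k′‖₁+‖tk‖₁) + 2(‖t³k′‖₁+‖t²k‖₁)/ℓ + (‖t⁴k′‖₁+‖t³k‖₁)/ℓ²] + (L₁+L₂)[‖tk‖₁ + 2‖t²k‖₁/ℓ + ‖t³k‖₁/ℓ²]`. [folklore] -/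
theorem norm_modelOperator_far_le_weighted_sq {q G : ℝ} (hq : 0 < q) {k k' : ℝ → ℝ} (hk : ∀ t, HasDerivAt k (k' t) t) (hk'c : Continuous k')
    (hki : Integrable k) (hk1 : Integrable fun t => t * k t) (hk2 : Integrable fun t => t ^ 2 * k t) (hk3 : Integrable fun t => t ^ 3 * k t)
    (hk'2 : Integrable fun t => t ^ 2 * k' t) (hk'3 : Integrable fun t => t ^ 3 * k' t) (hk'4 : Integrable fun t => t ^ 4 * k' t)
    {Mk : ℝ} (hkM : ∀ t, |k t| ≤ Mk)
    {Y : ℝ → ℂ} (hY : ContDiff ℝ 1 Y) (hYs : HasCompactSupport Y)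
    {w : ℝ → ℝ} (hw : Differentiable ℝ w) (hw2 : Differentiable ℝ (deriv w)) {Λ Λ₂ : ℝ} (hΛ : ∀ t, |deriv w t| ≤ Λ)
    (hΛ₂ : ∀ t, |deriv (deriv w) t| ≤ Λ₂)
    {β₁ β₂ : ℝ → ℂ} (hβ₁c : Continuous β₁) (hβ₂c : Continuous β₂) {b₁ b₂ L₁ L₂ : ℝ}
    (hb₁ : ∀ τ, ‖β₁ τ‖ ≤ b₁) (hb₂ : ∀ τ, ‖β₂ τ‖ ≤ b₂) (hL₁ : ∀ x y, ‖β₁ y - β₁ x‖ ≤ L₁ * |y - x|)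
    (hL₂ : ∀ x y, ‖β₂ y - β₂ x‖ ≤ L₂ * |y - x|)
    {SL S ℓ p c : ℝ} (hS : 0 ≤ S) (hℓ : 0 < ℓ) (hp0 : 0 ≤ p) (hp2 : p ≤ 2)
    (hSL : ∀ y : ℝ, ‖I * (G : ℂ) * ((2 / q : ℂ) * Y y
          - ∫ σ : ℝ, ((((2 * q - (y - σ) ^ 2) * (((y - σ) ^ 2 + q) ^ (5 / 2 : ℝ))⁻¹ : ℝ)) : ℂ) * Y σ)
        - ((w y : ℝ) : ℂ) * deriv Y y + β₁ y * Y y + β₂ y * conj (Y y)‖ ≤ SL)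
    (hSY : ∀ y : ℝ, ‖Y y‖ ≤ S * (1 + |y - c| / ℓ) ^ p) (x : ℝ) :
    ‖I * (G : ℂ) * ((2 / q : ℂ) * (Y x - ∫ y : ℝ, ((k (x - y) : ℝ) : ℂ) * Y y)
          - ∫ σ : ℝ, ((((2 * q - (x - σ) ^ 2) * (((x - σ) ^ 2 + q) ^ (5 / 2 : ℝ))⁻¹ : ℝ)) : ℂ) * (Y σ - ∫ y : ℝ, ((k (σ - y) : ℝ) : ℂ) * Y y))
        - ((w x : ℝ) : ℂ) * (deriv Y x - ∫ y : ℝ, ((k (x - y) : ℝ) : ℂ) * deriv Y y) + β₁ x * (Y x - ∫ y : ℝ, ((k (x - y) : ℝ) : ℂ) * Y y)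
        + β₂ x * conj (Y x - ∫ y : ℝ, ((k (x - y) : ℝ) : ℂ) * Y y)‖
      ≤ (1 + ∫ t, |k t|) * SL + Λ * ‖∫ y : ℝ, (((x - y) * k' (x - y) + k (x - y) : ℝ) : ℂ) * Y y‖
        + (Λ₂ * (((∫ t, t ^ 2 * |k' t|) + (∫ t, |t| * |k t|))
              + 2 * ((∫ t, |t| ^ 3 * |k' t|) + (∫ t, t ^ 2 * |k t|)) / ℓ
              + ((∫ t, t ^ 4 * |k' t|) + (∫ t, |t| ^ 3 * |k t|)) / ℓ ^ 2)
            + (L₁ + L₂) * ((∫ t, |t| * |k t|) + 2 * (∫ t, t ^ 2 * |k t|) / ℓ + (∫ t, |t| ^ 3 * |k t|) / ℓ ^ 2))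
          * S * (1 + |x - c| / ℓ) ^ p := by
  have hkc : Continuous k := continuous_iff_continuousAt.2 fun t => (hk t).continuousAt
  have hYc := hY.continuous
  rw [modelOperator_far_eq (G := G) hq hk hk'c hki hkM hY hYs hw hw2 hΛ hβ₁c hβ₂c hb₁ hb₂ x]
  set LY : ℝ → ℂ := fun y => I * (G : ℂ) * ((2 / q : ℂ) * Y y
          - ∫ σ : ℝ, ((((2 * q - (y - σ) ^ 2) * (((y - σ) ^ 2 + q) ^ (5 / 2 : ℝ))⁻¹ : ℝ)) : ℂ) * Y σ)
        - ((w y : ℝ) : ℂ) * deriv Y y + β₁ y * Y y + β₂ y * conj (Y y) with hLY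
  set A : ℂ := ∫ y : ℝ, ((k (x - y) : ℝ) : ℂ) * LY y with hA
  set PT : ℂ := ∫ y : ℝ, (((x - y) * k' (x - y) + k (x - y) : ℝ) : ℂ) * Y y with hPT
  set Rm : ℂ := ∫ y : ℝ, ((k' (x - y) * (w y - w x - deriv w x * (y - x)) - k (x - y) * (deriv w y - deriv w x) : ℝ) : ℂ) * Y y with hRm
  set M1 : ℂ := ∫ y, ((k (x - y) : ℝ) : ℂ) * (β₁ y - β₁ x) * Y y with hM1
  set M2 : ℂ := ∫ y, ((k (x - y) : ℝ) : ℂ) * (β₂ y - β₂ x) * conj (Y y) with hM2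
  set ω : ℝ := (1 + |x - c| / ℓ) ^ p with hω
  have hω0 : 0 < ω := Real.rpow_pos_of_pos (by positivity) _
  have hL1 : 0 ≤ L₁ := by
    have := hL₁ 0 1; rw [sub_zero, abs_one, mul_one] at this; exact (norm_nonneg _).trans this
  have hL2 : 0 ≤ L₂ := by
    have := hL₂ 0 1; rw [sub_zero, abs_one, mul_one] at this; exact (norm_nonneg _).trans this
  have hΛ20 : 0 ≤ Λ₂ := (abs_nonneg _).trans (hΛ₂ 0)
  -- moments in `| · |` form
  have hi1 : Integrable fun t => |t| * |k t| := by
    refine hk1.abs.congr (ae_of_all _ fun t => ?_); simp only [abs_mul]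
  have hi2k : Integrable fun t => t ^ 2 * |k t| := by
    refine hk2.abs.congr (ae_of_all _ fun t => ?_); simp only [abs_mul, abs_pow, sq_abs]
  have hi3k : Integrable fun t => |t| ^ 3 * |k t| := by
    refine hk3.abs.congr (ae_of_all _ fun t => ?_); simp only [abs_mul, abs_pow]
  have hi2 : Integrable fun t => t ^ 2 * |k' t| := by
    refine hk'2.abs.congr (ae_of_all _ fun t => ?_); simp only [abs_mul, abs_pow, sq_abs]
  have hi3 : Integrable fun t => |t| ^ 3 * |k' t| := by
    refine hk'3.abs.congr (ae_of_all _ fun t => ?_); simp only [abs_mul, abs_pow]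
  have hi4 : Integrable fun t => t ^ 4 * |k' t| := by
    refine hk'4.abs.congr (ae_of_all _ fun t => ?_)
    simp only [abs_mul, abs_pow]
    rw [show (4 : ℕ) = 2 * 2 by norm_num, pow_mul, pow_mul, sq_abs]
  have h0 : ‖LY x‖ ≤ SL := hSL x
  have h1 : ‖A‖ ≤ (∫ t, |k t|) * SL := norm_integral_kernel_mul_le_sup hki hSL x
  have h2 : ‖((deriv w x : ℝ) : ℂ) * PT‖ ≤ Λ * ‖PT‖ := by
    rw [norm_mul, Complex.norm_real, Real.norm_eq_abs]
    exact mul_le_mul_of_nonneg_right (hΛ x) (norm_nonneg _)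
  -- remainder: weight `K = Λ₂(t²|k′| + |t||k|)`, `|t|K = Λ₂(|t|³|k′| + t²|k|)`, `t²K = Λ₂(t⁴|k′| + |t|³|k|)`
  have h3 : ‖Rm‖ ≤ (Λ₂ * ((∫ t, t ^ 2 * |k' t|) + (∫ t, |t| * |k t|))
      + 2 * (Λ₂ * ((∫ t, |t| ^ 3 * |k' t|) + (∫ t, t ^ 2 * |k t|))) / ℓ
      + Λ₂ * ((∫ t, t ^ 4 * |k' t|) + (∫ t, |t| ^ 3 * |k t|)) / ℓ ^ 2) * S * ω := by
    have hdom := norm_transportCommutatorRemainder_le hk hk'c hw hw2 hΛ₂ hYc hYs x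
    set K : ℝ → ℝ := fun t => Λ₂ * (t ^ 2 * |k' t| + |t| * |k t|) with hK
    have hKi : Integrable K := (hi2.add hi1).const_mul Λ₂
    have hKnn : ∀ t, 0 ≤ K t := fun t => by positivity
    have hK1 : Integrable fun t => |t| * |K t| := by
      have h : Integrable fun t => Λ₂ * (|t| ^ 3 * |k' t| + t ^ 2 * |k t|) := (hi3.add hi2k).const_mul Λ₂
      refine h.congr (ae_of_all _ fun t => ?_)
      show Λ₂ * (|t| ^ 3 * |k' t| + t ^ 2 * |k t|) = |t| * |K t|
      rw [abs_of_nonneg (hKnn t)]; simp only [hK]; rw [← sq_abs t]; ring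
    have hK2 : Integrable fun t => t ^ 2 * |K t| := by
      have h : Integrable fun t => Λ₂ * (t ^ 4 * |k' t| + |t| ^ 3 * |k t|) := (hi4.add hi3k).const_mul Λ₂
      refine h.congr (ae_of_all _ fun t => ?_)
      show Λ₂ * (t ^ 4 * |k' t| + |t| ^ 3 * |k t|) = t ^ 2 * |K t|
      rw [abs_of_nonneg (hKnn t)]; simp only [hK]; rw [show t ^ 4 = (t ^ 2) ^ 2 by ring, ← sq_abs t]; ring
    have hsup := integral_kernel_mul_norm_le_weightedSup_sq hKi hK1 hK2 hYc hS hℓ hp0 hp2 hSY x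
    have hKabs : ∫ t, |K t| = Λ₂ * ((∫ t, t ^ 2 * |k' t|) + ∫ t, |t| * |k t|) := by
      have habs : (fun t => |K t|) = fun t => Λ₂ * (t ^ 2 * |k' t| + |t| * |k t|) := funext fun t => abs_of_nonneg (hKnn t)
      rw [habs, integral_const_mul, integral_add hi2 hi1]
    have hKabs1 : ∫ t, |t| * |K t| = Λ₂ * ((∫ t, |t| ^ 3 * |k' t|) + ∫ t, t ^ 2 * |k t|) := by
      have habs : (fun t => |t| * |K t|) = fun t => Λ₂ * (|t| ^ 3 * |k' t| + t ^ 2 * |k t|) := by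
        funext t; rw [abs_of_nonneg (hKnn t)]; simp only [hK]; rw [← sq_abs t]; ring
      rw [habs, integral_const_mul, integral_add hi3 hi2k]
    have hKabs2 : ∫ t, t ^ 2 * |K t| = Λ₂ * ((∫ t, t ^ 4 * |k' t|) + ∫ t, |t| ^ 3 * |k t|) := by
      have habs : (fun t => t ^ 2 * |K t|) = fun t => Λ₂ * (t ^ 4 * |k' t| + |t| ^ 3 * |k t|) := by
        funext t; rw [abs_of_nonneg (hKnn t)]; simp only [hK]; rw [show t ^ 4 = (t ^ 2) ^ 2 by ring, ← sq_abs t]; ring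
      rw [habs, integral_const_mul, integral_add hi4 hi3k]
    have e : (fun y : ℝ => K (x - y) * ‖Y y‖) = fun y => (Λ₂ * ((x - y) ^ 2 * |k' (x - y)| + |x - y| * |k (x - y)|)) * ‖Y y‖ := rfl
    rw [e, hKabs, hKabs1, hKabs2] at hsup
    exact hdom.trans hsup
  have h45 : ∀ {L : ℝ} (βf : ℝ → ℂ) (g : ℝ → ℂ), 0 ≤ L → (∀ x y, ‖βf y - βf x‖ ≤ L * |y - x|) → Continuous g → HasCompactSupport g →
      (∀ y, ‖g y‖ ≤ S * (1 + |y - c| / ℓ) ^ p) →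
      ‖∫ y, ((k (x - y) : ℝ) : ℂ) * (βf y - βf x) * g y‖
        ≤ (L * (∫ t, |t| * |k t|) + 2 * (L * (∫ t, t ^ 2 * |k t|)) / ℓ + L * (∫ t, |t| ^ 3 * |k t|) / ℓ ^ 2) * S * ω := by
    intro L βf g hL hLip hgc hgs hgb
    have hdom := norm_multiplierCommutator_le (f := g) hkc hLip hgc hgs x
    set K : ℝ → ℝ := fun t => L * (|t| * |k t|) with hK
    have hKi : Integrable K := hi1.const_mul L
    have hKnn : ∀ t, 0 ≤ K t := fun t => by positivity
    have hK1 : Integrable fun t => |t| * |K t| := by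
      refine (hi2k.const_mul L).congr (ae_of_all _ fun t => ?_)
      show L * (t ^ 2 * |k t|) = |t| * |K t|
      rw [abs_of_nonneg (hKnn t)]; simp only [hK]; rw [← sq_abs t]; ring
    have hK2 : Integrable fun t => t ^ 2 * |K t| := by
      refine (hi3k.const_mul L).congr (ae_of_all _ fun t => ?_)
      show L * (|t| ^ 3 * |k t|) = t ^ 2 * |K t|
      rw [abs_of_nonneg (hKnn t)]; simp only [hK]; rw [← sq_abs t]; ring
    have hsup := integral_kernel_mul_norm_le_weightedSup_sq hKi hK1 hK2 hgc hS hℓ hp0 hp2 hgb x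
    have hKabs : ∫ t, |K t| = L * ∫ t, |t| * |k t| := by
      have habs : (fun t => |K t|) = fun t => L * (|t| * |k t|) := funext fun t => abs_of_nonneg (hKnn t)
      rw [habs, integral_const_mul]
    have hKabs1 : ∫ t, |t| * |K t| = L * ∫ t, t ^ 2 * |k t| := by
      have habs : (fun t => |t| * |K t|) = fun t => L * (t ^ 2 * |k t|) := by
        funext t; rw [abs_of_nonneg (hKnn t)]; simp only [hK]; rw [← sq_abs t]; ring
      rw [habs, integral_const_mul]
    have hKabs2 : ∫ t, t ^ 2 * |K t| = L * ∫ t, |t| ^ 3 * |k t| := by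
      have habs : (fun t => t ^ 2 * |K t|) = fun t => L * (|t| ^ 3 * |k t|) := by
        funext t; rw [abs_of_nonneg (hKnn t)]; simp only [hK]; rw [← sq_abs t]; ring
      rw [habs, integral_const_mul]
    have e : (fun y : ℝ => K (x - y) * ‖g y‖) = fun y => (L * (|x - y| * |k (x - y)|)) * ‖g y‖ := rfl
    rw [e, hKabs, hKabs1, hKabs2] at hsup
    exact hdom.trans hsup
  have h4 := h45 β₁ Y hL1 hL₁ hYc hYs hSY
  have hYcc : Continuous fun y => conj (Y y) := Complex.continuous_conj.comp hYc
  have hYcs : HasCompactSupport fun y => conj (Y y) := hYs.comp_left (g := conj) (map_zero _)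
  have hSY' : ∀ y : ℝ, ‖conj (Y y)‖ ≤ S * (1 + |y - c| / ℓ) ^ p := fun y => by rw [Complex.norm_conj]; exact hSY y
  have h5 := h45 β₂ (fun y => conj (Y y)) hL2 hL₂ hYcc hYcs hSY'
  calc ‖(((((LY x - A) + ((deriv w x : ℝ) : ℂ) * PT) - Rm) + M1) + M2)‖
      ≤ ‖LY x‖ + ‖A‖ + ‖((deriv w x : ℝ) : ℂ) * PT‖ + ‖Rm‖ + ‖M1‖ + ‖M2‖ := by
        have t1 := norm_sub_le (LY x) A
        have t2 := norm_add_le (LY x - A) (((deriv w x : ℝ) : ℂ) * PT)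
        have t3 := norm_sub_le ((LY x - A) + ((deriv w x : ℝ) : ℂ) * PT) Rm
        have t4 := norm_add_le (((LY x - A) + ((deriv w x : ℝ) : ℂ) * PT) - Rm) M1
        have t5 := norm_add_le ((((LY x - A) + ((deriv w x : ℝ) : ℂ) * PT) - Rm) + M1) M2
        linarith
    _ ≤ SL + (∫ t, |k t|) * SL + Λ * ‖PT‖
          + (Λ₂ * ((∫ t, t ^ 2 * |k' t|) + (∫ t, |t| * |k t|))
              + 2 * (Λ₂ * ((∫ t, |t| ^ 3 * |k' t|) + (∫ t, t ^ 2 * |k t|))) / ℓ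
              + Λ₂ * ((∫ t, t ^ 4 * |k' t|) + (∫ t, |t| ^ 3 * |k t|)) / ℓ ^ 2) * S * ω
          + (L₁ * (∫ t, |t| * |k t|) + 2 * (L₁ * (∫ t, t ^ 2 * |k t|)) / ℓ + L₁ * (∫ t, |t| ^ 3 * |k t|) / ℓ ^ 2) * S * ω
          + (L₂ * (∫ t, |t| * |k t|) + 2 * (L₂ * (∫ t, t ^ 2 * |k t|)) / ℓ + L₂ * (∫ t, |t| ^ 3 * |k t|) / ℓ ^ 2) * S * ω := by
        linarith
    _ = _ := by simp only [hω]; ring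

end Summit.NavierStokesRegularity.NavierStokesRegularity.Theorems.MatchedKernel

end
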